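import Literature.Algebra.Semigroups.FullTransformationGenerators

/-!
# Maximal subsemigroups of the full transformation semigroup `𝒯ₙ`

[Ganyushkin–Mazorchuk 2009, §5.4.3, Theorem 5.4.2 (case `𝒯ₙ`)].  A subsemigroup `T ⫋ S` is
*maximal* if no subsemigroup lies strictly between `T` and `S`, i.e. `T` is a coatom of the
lattice `Subsemigroup S`.  For `𝒯(X)` (`X` finite with `n ≥ 2` elements; as a monoid this is
Mathlib's `Function.End X`, `im α = Set.range α`, `rank α = |im α|`, `𝒮ₙ` = the bijections,
`ℐ_k` = the ideal of transformations of rank `≤ k`):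

* `𝒮ₙ ∪ ℐₙ₋₂` and `ℐₙ₋₁ ∪ G`, `G` a subgroup of `𝒮ₙ`, are subsemigroups
  (`mul_mem_bijective_union_rank_le`, `mul_mem_rank_lt_union_subgroup`);
* Theorem 5.4.2: the maximal subsemigroups of `𝒯ₙ` are exactly `𝒮ₙ ∪ ℐₙ₋₂` and the
  `ℐₙ₋₁ ∪ G` with `G` a maximal subgroup of `𝒮ₙ` (`isCoatom_iff`).  Subgroups of `𝒮ₙ` are taken
  as subgroups of the unit group `(Function.End X)ˣ` (which *is* `𝒮ₙ`: Mathlib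
  `Equiv.Perm.equivUnitsEnd : Equiv.Perm X ≃* (Function.End X)ˣ`).

The proof follows the book: a maximal `T` not containing `𝒮ₙ` absorbs the ideal `ℐₙ₋₁` and meets
`𝒮ₙ` in a maximal subgroup; a maximal `T ⊇ 𝒮ₙ` contains no element of rank `n - 1` by
Theorem 3.1.3 (`closure_bijective_insert_eq_top`).

## References
* [GanyushkinMazorchuk2009] O. Ganyushkin, V. Mazorchuk, *Classical Finite Transformation
  Semigroups. An Introduction*, Algebra and Applications 9, Springer, 2009, §5.4.3.
-/

namespace Literature.Algebra.Semigroups.FullTransformation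

open Function Set

variable {X : Type*}

/-! ### Ranks and units -/

/-- `rank α ≤ n`. [folklore] -/
private theorem rank_le [Finite X] (α : Function.End X) : (range α).ncard ≤ Nat.card X := by
  rw [← ncard_univ]
  exact ncard_le_ncard (subset_univ _)

/-- `α ∉ 𝒮ₙ` iff `rank α < n`. [folklore] -/
private theorem not_bijective_iff_rank_lt [Finite X] (α : Function.End X) :
    ¬ Bijective α ↔ (range α).ncard < Nat.card X := by
  rw [lt_iff_le_and_ne]
  exact ⟨fun h => ⟨rank_le α, fun h' => h (bijective_of_ncard_range_eq h')⟩,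
    fun h h' => h.2 (ncard_range_of_bijective h')⟩

/-- `rank (αβ) ≤ rank β` and `rank (αβ) ≤ rank α`. [folklore] -/
private theorem rank_mul_le [Finite X] (α β : Function.End X) :
    (range (α * β)).ncard ≤ (range β).ncard ∧ (range (α * β)).ncard ≤ (range α).ncard :=
  ⟨ncard_range_comp_le_right α β, ncard_range_comp_le_left α β⟩

/-- For `n ≥ 2` there is a transformation of rank `n - 1`. [folklore] -/
private theorem exists_rank_pred [Finite X] [Nontrivial X] :
    ∃ δ : Function.End X, (range δ).ncard + 1 = Nat.card X := by
  classical
  obtain ⟨b₁, b₂, hb⟩ := exists_pair_ne X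
  exact ⟨update id b₂ b₁, ncard_range_update_id hb⟩

/-- Units of `𝒯(X)` are bijections. [folklore] -/
private theorem bijective_val (u : (Function.End X)ˣ) : Bijective (u : Function.End X) :=
  bijective_iff_has_inverse.2 ⟨(↑u⁻¹ : Function.End X), fun x => congrFun u.inv_val x,
    fun x => congrFun u.val_inv x⟩

/-- A bijection of `X` is (the value of) a unit of `𝒯(X)`. [folklore] -/
private theorem exists_unit_of_bijective {σ : Function.End X} (hσ : Bijective σ) :
    ∃ u : (Function.End X)ˣ, (u : Function.End X) = σ :=
  ⟨Equiv.Perm.equivUnitsEnd (Equiv.ofBijective σ hσ), rfl⟩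

/-! ### The two families of subsemigroups -/

/-- `𝒮ₙ ∪ ℐₙ₋₂` is a subsemigroup of `𝒯ₙ` (`ℐₙ₋₂ = {α : rank α ≤ n - 2}` is an ideal).
[cite: GanyushkinMazorchuk2009, §5.4.3 (proof of Theorem 5.4.2)] -/
theorem mul_mem_bijective_union_rank_le [Finite X] {α β : Function.End X}
    (hα : α ∈ {σ : Function.End X | Bijective σ} ∪ {γ | (range γ).ncard + 2 ≤ Nat.card X})
    (hβ : β ∈ {σ : Function.End X | Bijective σ} ∪ {γ | (range γ).ncard + 2 ≤ Nat.card X}) :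
    α * β ∈ {σ : Function.End X | Bijective σ} ∪ {γ | (range γ).ncard + 2 ≤ Nat.card X} := by
  rcases hβ with hβ | hβ
  · rcases hα with hα | hα
    · exact Or.inl (hα.comp hβ)
    · right
      have := (rank_mul_le α β).2
      simp only [mem_setOf_eq] at hα ⊢
      omega
  · right
    have := (rank_mul_le α β).1
    simp only [mem_setOf_eq] at hβ ⊢
    omega

/-- `ℐₙ₋₁ ∪ G` is a subsemigroup of `𝒯ₙ` for every subgroup `G` of `𝒮ₙ = 𝒯ₙ*` (`ℐₙ₋₁`, the
non-bijective transformations, is an ideal). [cite: GanyushkinMazorchuk2009, §5.4.3] -/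
theorem mul_mem_rank_lt_union_subgroup [Finite X] (G : Subgroup (Function.End X)ˣ)
    {α β : Function.End X}
    (hα : α ∈ {γ : Function.End X | (range γ).ncard < Nat.card X} ∪ {σ | ∃ g ∈ G, ↑g = σ})
    (hβ : β ∈ {γ : Function.End X | (range γ).ncard < Nat.card X} ∪ {σ | ∃ g ∈ G, ↑g = σ}) :
    α * β ∈ {γ : Function.End X | (range γ).ncard < Nat.card X} ∪ {σ | ∃ g ∈ G, ↑g = σ} := by
  rcases hβ with hβ | ⟨g, hg, rfl⟩
  · left
    exact lt_of_le_of_lt (rank_mul_le α β).1 hβ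
  · rcases hα with hα | ⟨h, hh, rfl⟩
    · left
      exact lt_of_le_of_lt (rank_mul_le α _).2 hα
    · right
      exact ⟨h * g, G.mul_mem hh hg, Units.val_mul h g⟩

/-! ### Lemmas for Theorem 5.4.2 -/

/-- Theorem 3.1.3 in subsemigroup form: a subsemigroup of `𝒯ₙ` containing `𝒮ₙ` and an element
of rank `n - 1` is all of `𝒯ₙ`. [cite: GanyushkinMazorchuk2009, Theorem 3.1.3] -/
theorem eq_top_of_bijective_subset_of_rank_pred_mem [Finite X] {T : Subsemigroup (Function.End X)}
    (hS : {σ : Function.End X | Bijective σ} ⊆ T) {α : Function.End X}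
    (hα : (range α).ncard + 1 = Nat.card X) (hαT : α ∈ T) : T = ⊤ := by
  let U : Submonoid (Function.End X) := { T with one_mem' := hS bijective_id }
  have hU : Submonoid.closure (insert α {σ : Function.End X | Bijective σ}) ≤ U :=
    Submonoid.closure_le.2 (insert_subset hαT hS)
  rw [closure_bijective_insert_eq_top hα, top_le_iff] at hU
  ext x
  exact ⟨fun _ => trivial, fun _ => show x ∈ U by rw [hU]; trivial⟩

/-- A subsemigroup of `𝒯ₙ` containing the identity meets `𝒮ₙ` in a subgroup (`𝒮ₙ` is finite,
so inverses are powers). [folklore] -/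
private theorem exists_subgroup_eq [Finite X] (T : Subsemigroup (Function.End X))
    (h1 : (1 : Function.End X) ∈ T) :
    ∃ G : Subgroup (Function.End X)ˣ, ∀ g, g ∈ G ↔ (g : Function.End X) ∈ T := by
  haveI : Finite (Function.End X) := show Finite (X → X) from inferInstance
  haveI : Finite (Function.End X)ˣ := Finite.of_injective _ Units.val_injective
  have hpow : ∀ g : (Function.End X)ˣ, (g : Function.End X) ∈ T →
      ∀ k : ℕ, ((g ^ k : (Function.End X)ˣ) : Function.End X) ∈ T := by
    intro g hg k
    induction k with
    | zero => rw [pow_zero, Units.val_one]; exact h1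
    | succ k ih =>
      rw [pow_succ, Units.val_mul]
      exact T.mul_mem ih hg
  let G : Subgroup (Function.End X)ˣ :=
    { carrier := {g | (g : Function.End X) ∈ T}
      mul_mem' := fun {a b} ha hb => by
        show ((a * b : (Function.End X)ˣ) : Function.End X) ∈ T
        rw [Units.val_mul]
        exact T.mul_mem ha hb
      one_mem' := by
        show ((1 : (Function.End X)ˣ) : Function.End X) ∈ T
        rw [Units.val_one]
        exact h1
      inv_mem' := fun {g} hg => by
        show ((g⁻¹ : (Function.End X)ˣ) : Function.End X) ∈ T
        have hord := pow_orderOf_eq_one g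
        obtain ⟨k, hk⟩ := Nat.exists_eq_add_of_le (orderOf_pos g)
        rw [hk, add_comm, pow_succ] at hord
        rw [← eq_inv_of_mul_eq_one_left hord]
        exact hpow g hg k }
  exact ⟨G, fun g => Iff.rfl⟩

/-- A maximal subsemigroup of `𝒯ₙ` (`n ≥ 2`) contains the identity. [folklore] -/
private theorem one_mem_of_isCoatom [Finite X] [Nontrivial X] {T : Subsemigroup (Function.End X)}
    (hT : IsCoatom T) : (1 : Function.End X) ∈ T := by
  classical
  by_contra h1
  -- `T ∪ {1}` is a subsemigroup strictly between `T` and `𝒯ₙ`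
  let U : Subsemigroup (Function.End X) :=
    { carrier := insert 1 (T : Set (Function.End X))
      mul_mem' := by
        rintro a b (rfl | ha) (rfl | hb)
        · exact Or.inl (one_mul 1)
        · rw [one_mul]; exact Or.inr hb
        · rw [mul_one]; exact Or.inr ha
        · exact Or.inr (T.mul_mem ha hb) }
  have hTU : T < U := by
    refine lt_of_le_of_ne (fun x hx => Or.inr hx) fun h => h1 ?_
    rw [h]
    exact Or.inl rfl
  have hU := hT.2 U hTU
  -- a transposition `τ` is not in `U`: `τ ≠ 1`, and `τ ∈ T` would give `1 = τ² ∈ T`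
  obtain ⟨a, b, hab⟩ := exists_pair_ne X
  let τ : (Function.End X)ˣ := Equiv.Perm.equivUnitsEnd (Equiv.swap a b)
  have hτ1 : (τ : Function.End X) ≠ 1 := by
    intro h
    have h2 : (τ : Function.End X) a = (1 : Function.End X) a := by rw [h]
    change Equiv.swap a b a = a at h2
    rw [Equiv.swap_apply_left] at h2
    exact hab h2.symm
  have hττ : (τ : Function.End X) * τ = 1 := by
    rw [← Units.val_mul, ← map_mul, Equiv.swap_mul_self, map_one, Units.val_one]
  have hτU : (τ : Function.End X) ∈ U := by rw [hU]; trivial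
  rcases hτU with h | h
  · exact hτ1 h
  · exact h1 (hττ ▸ T.mul_mem h h)

/-! ### Theorem 5.4.2 -/

/-- Theorem 5.4.2 (case `𝒯ₙ`, `n ≥ 2`): a subsemigroup `T` of `𝒯ₙ` is maximal iff either
`T = 𝒮ₙ ∪ ℐₙ₋₂`, or `T = ℐₙ₋₁ ∪ G` for a maximal subgroup `G` of the symmetric group
`𝒮ₙ = 𝒯ₙ*`. [cite: GanyushkinMazorchuk2009, Theorem 5.4.2] -/
theorem isCoatom_iff [Finite X] [Nontrivial X] (T : Subsemigroup (Function.End X)) :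
    IsCoatom T ↔
      (T : Set (Function.End X)) =
          {σ : Function.End X | Bijective σ} ∪ {γ | (range γ).ncard + 2 ≤ Nat.card X} ∨
        ∃ G : Subgroup (Function.End X)ˣ, IsCoatom G ∧
          (T : Set (Function.End X)) =
            {γ : Function.End X | (range γ).ncard < Nat.card X} ∪ {σ | ∃ g ∈ G, ↑g = σ} := by
  obtain ⟨δ, hδ⟩ := exists_rank_pred (X := X)
  have hδ1 : ¬ Bijective δ := by rw [not_bijective_iff_rank_lt]; omega
  have hδ2 : ¬ (range δ).ncard + 2 ≤ Nat.card X := by omega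
  have hnot : ∀ {σ : Function.End X}, Bijective σ → ¬ (range σ).ncard < Nat.card X :=
    fun hσ h => (not_bijective_iff_rank_lt _).2 h hσ
  -- the subsemigroup `𝒮ₙ ∪ ℐₙ₋₂`
  let A : Subsemigroup (Function.End X) :=
    { carrier := {σ : Function.End X | Bijective σ} ∪ {γ | (range γ).ncard + 2 ≤ Nat.card X}
      mul_mem' := fun ha hb => mul_mem_bijective_union_rank_le ha hb }
  have hAtop : A ≠ ⊤ := fun h => by
    have : δ ∈ A := by rw [h]; trivial
    exact this.elim hδ1 hδ2
  -- the subsemigroups `ℐₙ₋₁ ∪ G`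
  let B : Subgroup (Function.End X)ˣ → Subsemigroup (Function.End X) := fun G =>
    { carrier := {γ : Function.End X | (range γ).ncard < Nat.card X} ∪ {σ | ∃ g ∈ G, ↑g = σ}
      mul_mem' := fun ha hb => mul_mem_rank_lt_union_subgroup G ha hb }
  have hBmem : ∀ (G : Subgroup (Function.End X)ˣ) (u : (Function.End X)ˣ),
      (u : Function.End X) ∈ B G ↔ u ∈ G := by
    intro G u
    constructor
    · rintro (h | ⟨g, hg, hgu⟩)
      · exact absurd h (hnot (bijective_val u))
      · rwa [← Units.val_injective hgu]
    · exact fun h => Or.inr ⟨u, h, rfl⟩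
  constructor
  · intro hT
    have h1T := one_mem_of_isCoatom hT
    by_cases hS : {σ : Function.End X | Bijective σ} ⊆ T
    · -- Case `𝒮ₙ ⊆ T`: no element of rank `n - 1`, so `T ⊆ 𝒮ₙ ∪ ℐₙ₋₂`, hence equality
      left
      have hTA : T ≤ A := by
        intro t ht
        by_cases hb : Bijective t
        · exact Or.inl hb
        · right
          have h1 := (not_bijective_iff_rank_lt t).1 hb
          by_contra h2
          have hrk : (range t).ncard + 1 = Nat.card X := by
            simp only [mem_setOf_eq] at h2; omega
          exact hT.1 (eq_top_of_bijective_subset_of_rank_pred_mem hS hrk ht)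
      rcases hTA.lt_or_eq with h | h
      · exact absurd (hT.2 A h) hAtop
      · rw [h]; rfl
    · -- Case `𝒮ₙ ⊄ T`: `T` absorbs `ℐₙ₋₁` and `T ∩ 𝒮ₙ` is a maximal subgroup
      right
      obtain ⟨σ, hσ, hσT⟩ := not_subset.1 hS
      -- `T ∪ ℐₙ₋₁` is a proper subsemigroup containing `T`, hence equal to `T`
      let U : Subsemigroup (Function.End X) :=
        { carrier := (T : Set (Function.End X)) ∪ {γ | (range γ).ncard < Nat.card X}
          mul_mem' := by
            rintro a b (ha | ha) (hb | hb)
            · exact Or.inl (T.mul_mem ha hb)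
            · exact Or.inr (lt_of_le_of_lt (rank_mul_le a b).1 hb)
            · exact Or.inr (lt_of_le_of_lt (rank_mul_le a b).2 ha)
            · exact Or.inr (lt_of_le_of_lt (rank_mul_le a b).1 hb) }
      have hTU : T ≤ U := fun x hx => Or.inl hx
      have hUtop : U ≠ ⊤ := fun h => by
        have : σ ∈ U := by rw [h]; trivial
        exact this.elim hσT (hnot hσ)
      have hUT : U = T := by
        rcases hTU.lt_or_eq with h | h
        · exact absurd (hT.2 U h) hUtop
        · exact h.symm
      have hIT : {γ : Function.End X | (range γ).ncard < Nat.card X} ⊆ T := fun γ hγ => by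
        rw [← hUT]; exact Or.inr hγ
      obtain ⟨G, hG⟩ := exists_subgroup_eq T h1T
      have hTB : (T : Set (Function.End X)) = B G := by
        ext t
        constructor
        · intro ht
          by_cases hb : Bijective t
          · obtain ⟨u, rfl⟩ := exists_unit_of_bijective hb
            exact Or.inr ⟨u, (hG u).2 ht, rfl⟩
          · exact Or.inl ((not_bijective_iff_rank_lt t).1 hb)
        · rintro (ht | ⟨g, hg, rfl⟩)
          · exact hIT ht
          · exact (hG g).1 hg
      refine ⟨G, ⟨fun hGtop => hσT ?_, fun G' hGG' => ?_⟩, hTB⟩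
      · -- `G ≠ ⊤` since `σ ∉ T`
        obtain ⟨u, rfl⟩ := exists_unit_of_bijective hσ
        have : u ∈ G := by rw [hGtop]; trivial
        exact (hG u).1 this
      · -- a larger subgroup `G'` gives the subsemigroup `ℐₙ₋₁ ∪ G' ⊋ T`, hence `= 𝒯ₙ`
        have hTB' : T < B G' := by
          refine lt_of_le_of_ne (fun t ht => ?_) fun h => ?_
          · have : t ∈ (B G : Set (Function.End X)) := hTB ▸ ht
            rcases this with h | ⟨g, hg, rfl⟩
            · exact Or.inl h
            · exact Or.inr ⟨g, hGG'.le hg, rfl⟩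
          · obtain ⟨u, hu', hu⟩ := Set.exists_of_ssubset hGG'
            apply hu
            have hu2 : (u : Function.End X) ∈ (T : Set (Function.End X)) := by
              rw [h]
              exact (hBmem G' u).2 hu'
            rw [hTB] at hu2
            exact (hBmem G u).1 hu2
        have htop := hT.2 _ hTB'
        rw [eq_top_iff]
        intro u _
        rw [← hBmem G', htop]
        trivial
  · rintro (hA | ⟨G, hG, hB⟩)
    · -- `T = 𝒮ₙ ∪ ℐₙ₋₂` is maximal by Theorem 3.1.3
      have hTA : T = A := SetLike.coe_injective hA
      subst hTA
      refine ⟨hAtop, fun T' hT' => ?_⟩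
      obtain ⟨β, hβ', hβ⟩ := exists_of_ssubset hT'
      have hb : ¬ Bijective β := fun h => hβ (Or.inl h)
      have h2 : ¬ (range β).ncard + 2 ≤ Nat.card X := fun h => hβ (Or.inr h)
      have h1 := (not_bijective_iff_rank_lt β).1 hb
      exact eq_top_of_bijective_subset_of_rank_pred_mem (fun σ hσ => hT'.le (Or.inl hσ))
        (by omega) hβ'
    · -- `T = ℐₙ₋₁ ∪ G` with `G` a maximal subgroup
      have hTB : T = B G := SetLike.coe_injective hB
      subst hTB
      refine ⟨fun h => hG.1 ?_, fun T' hT' => ?_⟩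
      · rw [eq_top_iff]
        intro u _
        rw [← hBmem G, h]
        trivial
      · obtain ⟨β, hβ', hβ⟩ := exists_of_ssubset hT'
        have hb : Bijective β := by
          by_contra h
          exact hβ (Or.inl ((not_bijective_iff_rank_lt β).1 h))
        have h1T' : (1 : Function.End X) ∈ T' :=
          hT'.le (Or.inr ⟨1, G.one_mem, Units.val_one⟩)
        obtain ⟨G', hG'⟩ := exists_subgroup_eq T' h1T'
        have hGG' : G < G' := by
          refine lt_of_le_of_ne (fun g hg => (hG' g).2 (hT'.le (Or.inr ⟨g, hg, rfl⟩)))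
            fun h => hβ ?_
          obtain ⟨u, rfl⟩ := exists_unit_of_bijective hb
          refine Or.inr ⟨u, ?_, rfl⟩
          rw [h, hG']
          exact hβ'
        have hG'top := hG.2 G' hGG'
        rw [eq_top_iff]
        intro α _
        by_cases hα : Bijective α
        · obtain ⟨u, rfl⟩ := exists_unit_of_bijective hα
          have : u ∈ G' := by rw [hG'top]; trivial
          exact (hG' u).1 this
        · exact hT'.le (Or.inl ((not_bijective_iff_rank_lt α).1 hα))

end Literature.Algebra.Semigroups.FullTransformation
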